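import Literature.AlgebraicGeometry.HodgeTheory.UnitaryReflectionLieIrreducible
import HarnessLib

/-!
# Unitary reflection groups along one orbit of roots: the only non-zero `Ad(Γ)`-stable Lie subalgebra of
# `𝔰𝔩(W)` is `𝔰𝔩(W)` (Carlson–Toledo 1999 §7, Theorem `udensitytheo` — algebraic proof, part 3: the
# Lie core)

Family `hodge`, layer `Literature/AlgebraicGeometry/HodgeTheory`. THEOREMS only (no definition, no named
fact). Sequel of `UnitaryReflectionLieProjector` / `UnitaryReflectionLieIrreducible`; the linear-algebraic
heart of the ALGEBRAIC proof of Carlson–Toledo's density theorem (named fact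
`carlsonToledo1999_unitaryReflection_zariskiDense`). Reflection system as there: `B` a non-degenerate
sesquilinear form on the finite-dimensional complex space `W`, roots `δ ∈ Δ` with `B δ δ = ε`, `ε² = 1`,
spanning `W`, `Γ ≤ GL(W)` generated by the `λ`-reflections `s_δ = complexReflection B ε λ δ` and transitive
on `Δ`, `λ ∉ {0, 1, -1}`; `L ⊆ End(W)` a non-zero subspace of traceless endomorphisms closed under the
commutator bracket and under `Ad(γ)`, `γ ∈ Γ`.

* `smulRight_mem_of_mem_ker` — **`L` contains the rank-one maps `x ↦ B δ x • w` for every root `δ` and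
  every `w ∈ δ^⊥`.** With `π = π_δ`: the `λ⁻¹`-block `(1-π) Y π` of `Y ∈ L` is `x ↦ B δ x • ε(1-π)(Y δ)`
  and lies in `L` (component closure), so `M_δ := ℂδ + {w ∈ δ^⊥ : (B δ).smulRight w ∈ L}` contains `L δ`;
  bracketing `Y ∈ L` with `x ↦ B δ x • w` and taking the `λ⁻¹`-block shows `M_δ` is `L`-stable; as `W` is
  `L`-irreducible (`eq_bot_or_eq_top_of_forall_mem_map_mem`), `M_δ = W`.
* `mem_of_trace_eq_zero` — **THE LIE CORE: every traceless endomorphism lies in `L`.** Choose a basis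
  `δ_j ∈ Δ` and the `B`-dual basis `e_i` (`B δ_j e_i = [i = j]`); the matrix units
  `E_{ij} : x ↦ B δ_j x • e_i` (`i ≠ j`) lie in `L` by the previous result, `E_{ii} - E_{i₀i₀} =
  [E_{ii₀}, E_{i₀i}] ∈ L`, and these span `𝔰𝔩(W)`.

With the Zariski-closure / Lie-algebra dictionary of `Literature/NumberTheory/Automorphic` (nilpotent
elements of `Lie` exponentiate into the closure) this yields `SL(W) ⊆ (Γ^Zar)°(ℂ)` for every INFINITE such
`Γ`, and Carlson–Toledo's theorem (sequel files). Written by the prover seat `hodge-nonav-prover-Bx` (cell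
`hodge-nonav`) for crux K1 `VeryGeneralDeckCommutatorsInHg` of
`Summits/HodgeConjecture/HodgeConjecture/Theses/CyclicUnitaryPowers.lean` (`stmt-HodgeConjecture-19544`).

## References
* [CarlsonToledo1999] J. A. Carlson, D. Toledo, *Discriminant complements and kernels of monodromy
  representations*, Duke Math. J. 97 (1999) 621–648, §7 Theorem `udensitytheo` (arXiv alg-geom/9708002
  p. 15).
* [Deligne1980] P. Deligne, *La conjecture de Weil. II*, Publ. Math. IHÉS 52 (1980), §4.4.
-/

noncomputable section

open Module

namespace Literature.AlgebraicGeometry.HodgeTheory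

variable {W : Type*} [AddCommGroup W] [Module ℂ W]

/-! ### §1 The `λ⁻¹`-block as a rank-one map; `L ∋ (x ↦ B δ x • w)` for `w ∈ δ^⊥` -/

/-- The `λ⁻¹`-block of `C` with respect to `π_δ` is the rank-one map `x ↦ B δ x • ε (C δ - π_δ (C δ))`.
[cite: CarlsonToledo1999, §7 Theorem udensitytheo] -/
theorem sub_rootProj_mul_mul_rootProj_eq (B : W →ₗ⋆[ℂ] W →ₗ[ℂ] ℂ) (ε : ℂ) (δ : W) (C : Module.End ℂ W) :
    (1 - ε • (B δ).smulRight δ) * C * (ε • (B δ).smulRight δ) =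
      (B δ).smulRight (ε • (C δ - (ε • (B δ).smulRight δ) (C δ))) := by
  ext x
  simp only [Module.End.mul_apply, rootProj_apply, map_smul, LinearMap.sub_apply, Module.End.one_apply,
    LinearMap.smulRight_apply, smul_smul, smul_sub]
  module

/-- Linearity of `w ↦ (x ↦ B δ x • w)` (Mathlib's `smulRightₗ`). [folklore] -/
private theorem smulRight_add_smul (f : W →ₗ[ℂ] ℂ) (a b : ℂ) (u v : W) :
    f.smulRight (a • u + b • v) = a • f.smulRight u + b • f.smulRight v := by
  ext x; simp [smul_add, smul_smul, mul_comm]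

/-- `f.smulRight (a • u) = a • f.smulRight u`. [folklore] -/
private theorem smulRight_smul' (f : W →ₗ[ℂ] ℂ) (a : ℂ) (u : W) :
    f.smulRight (a • u) = a • f.smulRight u := by
  ext x; simp [smul_smul, mul_comm]

variable [FiniteDimensional ℂ W]

/-- **`L` contains `x ↦ B δ x • w` for every root `δ ∈ Δ` and every `w ∈ δ^⊥`.** (For a reflection system
and a non-zero subspace `L` of traceless endomorphisms closed under brackets and `Ad(Γ)`: the subspace
`M_δ = ℂδ + {w ∈ δ^⊥ : (x ↦ B δ x • w) ∈ L}` contains `L δ` (the `λ⁻¹`-block of `Y ∈ L` is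
`x ↦ B δ x • ε(1-π_δ)(Y δ)`) and is `L`-stable (the `λ⁻¹`-block of `[Y, x ↦ B δ x • w]` is
`x ↦ B δ x • (ε(1-π_δ)(Y w) - B δ (Y δ) • w)`), hence equals `W` by `L`-irreducibility.)
[cite: CarlsonToledo1999, §7 Theorem udensitytheo] -/
theorem smulRight_mem_of_mem_ker {B : W →ₗ⋆[ℂ] W →ₗ[ℂ] ℂ} (hBr : B.SeparatingRight) {ε : ℂ}
    (hε : ε * ε = 1) {l : ℂ} (hl0 : l ≠ 0) (hl1 : l ≠ 1) (hl2 : l * l ≠ 1) {Δ : Set W}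
    (hΔ : ∀ δ ∈ Δ, B δ δ = ε) (hspan : Submodule.span ℂ Δ = ⊤) {Γ : Subgroup (W ≃ₗ[ℂ] W)}
    (hΓ : Γ = Subgroup.closure {g : W ≃ₗ[ℂ] W | ∃ δ ∈ Δ, (g : W →ₗ[ℂ] W) = complexReflection B ε l δ})
    (htrans : ∀ δ ∈ Δ, ∀ δ' ∈ Δ, ∃ g ∈ Γ, g δ = δ') {L : Submodule ℂ (Module.End ℂ W)} (hL0 : L ≠ ⊥)
    (htr : ∀ Y ∈ L, LinearMap.trace ℂ W Y = 0) (hbr : ∀ Y ∈ L, ∀ Z ∈ L, Y * Z - Z * Y ∈ L)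
    (hAd : ∀ g ∈ Γ, ∀ Y ∈ L, (g : Module.End ℂ W) * Y * ((g⁻¹ : W ≃ₗ[ℂ] W) : Module.End ℂ W) ∈ L)
    {δ : W} (hδ : δ ∈ Δ) {w : W} (hw : B δ w = 0) : (B δ).smulRight w ∈ L := by
  classical
  have hε0 : ε ≠ 0 := by rintro rfl; norm_num at hε
  set π : Module.End ℂ W := ε • (B δ).smulRight δ with hπdef
  have hπ : π * π = π := rootProj_mul_self B hε (hΔ δ hδ)
  -- component closure at `δ`
  obtain ⟨g, hgΓ, hg⟩ : ∃ g ∈ Γ, (g : W →ₗ[ℂ] W) = complexReflection B ε l δ :=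
    ⟨complexReflectionEquiv B hε hl0 (hΔ δ hδ), hΓ ▸ Subgroup.subset_closure ⟨δ, hδ, rfl⟩, rfl⟩
  have hconj : ∀ Z ∈ L, (1 + (l - 1) • π) * Z * (1 + (l⁻¹ - 1) • π) ∈ L := by
    intro Z hZ
    have h := hAd g hgΓ Z hZ
    have hg' : (g : Module.End ℂ W) = 1 + (l - 1) • π := by
      rw [hπdef, ← complexReflection_eq_one_add_smul_rootProj, ← hg]
    rwa [hg', coe_inv_eq_one_add_smul_rootProj B hε hl0 (hΔ δ hδ) hg] at h
  have hblock : ∀ C ∈ L, (B δ).smulRight (C δ - π (C δ)) ∈ L := by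
    intro C hC
    have h := (offDiag_mem_of_conj_mem hπ hl0 hl1 hl2 hconj hC).2
    rw [hπdef, sub_rootProj_mul_mul_rootProj_eq, smulRight_smul'] at h
    have h' := L.smul_mem ε⁻¹ h
    rwa [smul_smul, inv_mul_cancel₀ hε0, one_smul] at h'
  -- the subspace `M_δ`
  set Bset : Submodule ℂ W := LinearMap.ker (B δ) ⊓ L.comap (LinearMap.smulRightₗ (B δ)) with hBset
  have hmemB : ∀ u : W, u ∈ Bset ↔ B δ u = 0 ∧ (B δ).smulRight u ∈ L := by
    intro u
    simp only [hBset, Submodule.mem_inf, LinearMap.mem_ker, Submodule.mem_comap,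
      LinearMap.smulRightₗ_apply]
  have hker : ∀ x : W, B δ (x - π x) = 0 := fun x => apply_sub_rootProj_mem_ker B hε (hΔ δ hδ) x
  have hπmem : ∀ x : W, π x ∈ Submodule.span ℂ {δ} := fun x => by
    rw [hπdef, rootProj_apply]; exact Submodule.smul_mem _ _ (Submodule.mem_span_singleton_self δ)
  have hπw : ∀ u : W, B δ u = 0 → π u = 0 := fun u hu => rootProj_apply_of_orthogonal B ε hu
  set M : Submodule ℂ W := Submodule.span ℂ {δ} ⊔ Bset with hM
  -- (a) `L δ ⊆ M`
  have ha : ∀ Y ∈ L, Y δ ∈ M := by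
    intro Y hY
    have hsplit : Y δ = π (Y δ) + (Y δ - π (Y δ)) := by abel
    rw [hsplit]
    exact Submodule.add_mem_sup (hπmem _) ((hmemB _).2 ⟨hker _, hblock Y hY⟩)
  -- (b) `L Bset ⊆ M`
  have hb : ∀ Y ∈ L, ∀ u ∈ Bset, Y u ∈ M := by
    intro Y hY u hu
    obtain ⟨hu0, huL⟩ := (hmemB u).1 hu
    have hC := hblock _ (hbr Y hY _ huL)
    have hCδ : (Y * (B δ).smulRight u - (B δ).smulRight u * Y) δ -
        π ((Y * (B δ).smulRight u - (B δ).smulRight u * Y) δ) =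
        ε • (Y u - π (Y u)) + (-(B δ (Y δ))) • u := by
      simp only [LinearMap.sub_apply, Module.End.mul_apply, LinearMap.smulRight_apply, hΔ δ hδ, map_sub,
        map_smul, hπw u hu0, smul_zero, sub_zero]
      module
    rw [hCδ, smulRight_add_smul] at hC
    have h1 : ε • (B δ).smulRight (Y u - π (Y u)) ∈ L := by
      have := L.sub_mem hC (L.smul_mem (-(B δ (Y δ))) huL)
      rwa [add_sub_cancel_right] at this
    have h2 : (B δ).smulRight (Y u - π (Y u)) ∈ L := by
      have := L.smul_mem ε h1
      rwa [smul_smul, hε, one_smul] at this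
    have hsplit : Y u = π (Y u) + (Y u - π (Y u)) := by abel
    rw [hsplit]
    exact Submodule.add_mem_sup (hπmem _) ((hmemB _).2 ⟨hker _, h2⟩)
  -- `M` is `L`-stable, hence `⊤`
  have hMstab : ∀ Y ∈ L, ∀ x ∈ M, Y x ∈ M := by
    intro Y hY x hx
    obtain ⟨y, hy, z, hz, rfl⟩ := Submodule.mem_sup.1 hx
    obtain ⟨c, rfl⟩ := Submodule.mem_span_singleton.1 hy
    rw [map_add, map_smul]
    exact M.add_mem (M.smul_mem c (ha Y hY)) (hb Y hY z hz)
  obtain ⟨N, hNL, hN0, hNN⟩ := exists_sq_eq_zero_mem hBr hε hl0 hl1 hl2 hΔ hspan hΓ htrans hL0 htr hAd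
  have hMtop : M = ⊤ := by
    rcases eq_bot_or_eq_top_of_forall_mem_map_mem hBr hε hl0 hl1 hΔ hspan hΓ htrans hAd hNL hN0 hNN
      hMstab with h | h
    · exfalso
      have hδM : δ ∈ M := Submodule.mem_sup_left (Submodule.mem_span_singleton_self δ)
      rw [h, Submodule.mem_bot] at hδM
      have := hΔ δ hδ
      simp only [hδM, map_zero] at this
      exact hε0 this.symm
    · exact h
  -- conclude
  have hwM : w ∈ M := by rw [hMtop]; exact Submodule.mem_top
  obtain ⟨y, hy, z, hz, hyz⟩ := Submodule.mem_sup.1 hwM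
  obtain ⟨c, rfl⟩ := Submodule.mem_span_singleton.1 hy
  obtain ⟨hz0, hzL⟩ := (hmemB z).1 hz
  have hc : c = 0 := by
    have h := congrArg (B δ) hyz
    rw [map_add, map_smul, hΔ δ hδ, hz0, add_zero, hw, smul_eq_mul] at h
    exact (mul_eq_zero.1 h).resolve_right hε0
  rw [hc, zero_smul, zero_add] at hyz
  rwa [← hyz]

/-! ### §2 The Lie core: `𝔰𝔩(W) ⊆ L` -/

omit [FiniteDimensional ℂ W] in
/-- Matrix units in a basis `e`: `E_{kl} x = e.repr x l • e k`, and `E_{ab} E_{cd} = [b = c] E_{ad}`. [folklore] -/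
private theorem coord_smulRight_mul {ι : Type*} [DecidableEq ι] (e : Basis ι ℂ W) (a b c d : ι) :
    (e.coord b).smulRight (e a) * (e.coord d).smulRight (e c) =
      (if b = c then (1 : ℂ) else 0) • (e.coord d).smulRight (e a) := by
  ext x
  by_cases h : b = c
  · subst h
    simp [LinearMap.smulRight_apply, Basis.coord_apply]
  · simp [LinearMap.smulRight_apply, Basis.coord_apply, h]

omit [FiniteDimensional ℂ W] in
/-- Expansion of an endomorphism in matrix units: `Y = Σ_{k,l} [Y]_{kl} E_{kl}`. [folklore] -/
private theorem eq_sum_coord_smulRight {ι : Type*} [Fintype ι] (e : Basis ι ℂ W) (Y : Module.End ℂ W) :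
    Y = ∑ l, ∑ k, e.repr (Y (e l)) k • (e.coord l).smulRight (e k) := by
  classical
  refine e.ext fun l₀ => ?_
  simp only [LinearMap.coe_sum, Finset.sum_apply, LinearMap.smul_apply, LinearMap.smulRight_apply,
    Basis.coord_apply, Basis.repr_self, Finsupp.single_apply]
  rw [Finset.sum_eq_single l₀ (fun l _ hl => by simp [Ne.symm hl]) (fun h => absurd (Finset.mem_univ _) h)]
  simp only [if_true, one_smul]
  exact (e.sum_repr (Y (e l₀))).symm

omit [FiniteDimensional ℂ W] in
/-- The trace is the sum of the diagonal coordinates: `tr Y = Σ_k [Y]_{kk}`. [folklore] -/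
private theorem trace_eq_sum_coord {ι : Type*} [Fintype ι] [DecidableEq ι] (e : Basis ι ℂ W)
    (Y : Module.End ℂ W) : LinearMap.trace ℂ W Y = ∑ k, e.repr (Y (e k)) k := by
  rw [LinearMap.trace_eq_matrix_trace ℂ e, Matrix.trace]
  simp [LinearMap.toMatrix_apply]

/-- **THE LIE CORE.** For a reflection system — `B` non-degenerate sesquilinear on the finite-dimensional
complex space `W`, roots `δ ∈ Δ` with `B δ δ = ε`, `ε² = 1`, spanning `W`, `Γ ≤ GL(W)` the subgroup
generated by the `λ`-reflections `complexReflection B ε λ δ`, transitive on `Δ`, `λ ∉ {0, 1, -1}` — every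
NON-ZERO subspace `L ⊆ End(W)` of traceless endomorphisms which is closed under the commutator bracket and
under `Ad(γ) : Y ↦ γ Y γ⁻¹` (`γ ∈ Γ`) contains every traceless endomorphism: `L = 𝔰𝔩(W)`. (Matrix units
`E_{ij} : x ↦ B δ_j x • e_i` for a basis `δ_j ∈ Δ` and its `B`-dual basis `e_i` lie in `L` for `i ≠ j`
by `smulRight_mem_of_mem_ker`; `E_{ii} - E_{i₀i₀} = [E_{ii₀}, E_{i₀i}]`; these span `𝔰𝔩(W)`.) This is
the algebraic heart of Carlson–Toledo's density theorem. [cite: CarlsonToledo1999, §7 Theorem udensitytheo] -/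
theorem mem_of_trace_eq_zero {B : W →ₗ⋆[ℂ] W →ₗ[ℂ] ℂ} (hBn : B.Nondegenerate) {ε : ℂ}
    (hε : ε * ε = 1) {l : ℂ} (hl0 : l ≠ 0) (hl1 : l ≠ 1) (hl2 : l * l ≠ 1) {Δ : Set W}
    (hΔ : ∀ δ ∈ Δ, B δ δ = ε) (hspan : Submodule.span ℂ Δ = ⊤) {Γ : Subgroup (W ≃ₗ[ℂ] W)}
    (hΓ : Γ = Subgroup.closure {g : W ≃ₗ[ℂ] W | ∃ δ ∈ Δ, (g : W →ₗ[ℂ] W) = complexReflection B ε l δ})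
    (htrans : ∀ δ ∈ Δ, ∀ δ' ∈ Δ, ∃ g ∈ Γ, g δ = δ') {L : Submodule ℂ (Module.End ℂ W)} (hL0 : L ≠ ⊥)
    (htr : ∀ Y ∈ L, LinearMap.trace ℂ W Y = 0) (hbr : ∀ Y ∈ L, ∀ Z ∈ L, Y * Z - Z * Y ∈ L)
    (hAd : ∀ g ∈ Γ, ∀ Y ∈ L, (g : Module.End ℂ W) * Y * ((g⁻¹ : W ≃ₗ[ℂ] W) : Module.End ℂ W) ∈ L)
    {Y : Module.End ℂ W} (hY : LinearMap.trace ℂ W Y = 0) : Y ∈ L := by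
  classical
  have hBr : B.SeparatingRight := hBn.2
  -- a basis of roots
  obtain ⟨b, hbΔ, hbspan, hbli⟩ := exists_linearIndependent ℂ Δ
  rw [hspan] at hbspan
  haveI : Finite b := hbli.finite
  letI : Fintype b := Fintype.ofFinite b
  have hvspan : ⊤ ≤ Submodule.span ℂ (Set.range (fun i : b => (i : W))) := by
    rw [Subtype.range_coe_subtype, Set.setOf_mem_eq, hbspan]
  let v : Basis b ℂ W := Basis.mk hbli hvspan
  have hv : ∀ i, v i = (i : W) := fun i => Basis.mk_apply hbli hvspan i
  have hvΔ : ∀ i, v i ∈ Δ := fun i => hv i ▸ hbΔ i.2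
  -- the `B`-dual basis `e`
  let Φ : W →ₗ[ℂ] (b → ℂ) := LinearMap.pi fun i => B (v i)
  have hΦ : ∀ x i, Φ x i = B (v i) x := fun x i => rfl
  have hΦinj : Function.Injective Φ := by
    rw [← LinearMap.ker_eq_bot, Submodule.eq_bot_iff]
    intro x hx
    rw [LinearMap.mem_ker] at hx
    refine hBr x fun y => ?_
    have hy : y ∈ Submodule.span ℂ (Set.range v) := by rw [v.span_eq]; exact Submodule.mem_top
    induction hy using Submodule.span_induction with
    | mem z hz => obtain ⟨i, rfl⟩ := hz; exact (hΦ x i).symm.trans (congrFun hx i)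
    | zero => simp
    | add y z _ _ hy hz => simp [map_add, hy, hz]
    | smul c y _ hy => simp [LinearMap.map_smulₛₗ, hy]
  have hΦbij : Function.Bijective Φ := by
    refine ⟨hΦinj, (LinearMap.injective_iff_surjective_of_finrank_eq_finrank ?_).1 hΦinj⟩
    rw [Module.finrank_fintype_fun_eq_card, Module.finrank_eq_card_basis v]
  let Φe : W ≃ₗ[ℂ] (b → ℂ) := LinearEquiv.ofBijective Φ hΦbij
  let e : Basis b ℂ W := Basis.ofEquivFun Φe
  have he_coord : ∀ l x, e.coord l x = B (v l) x := fun l x => by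
    rw [Basis.coord_apply, Basis.ofEquivFun_repr_apply]; rfl
  have he_dual : ∀ k l, B (v l) (e k) = if l = k then 1 else 0 := by
    intro k l
    rw [← he_coord, Basis.coord_apply, Basis.repr_self, Finsupp.single_apply]
    by_cases h : l = k
    · subst h; simp
    · simp [h, Ne.symm h]
  -- the matrix units with `k ≠ l` lie in `L`
  have hE : ∀ k l, k ≠ l → (e.coord l).smulRight (e k) ∈ L := by
    intro k l hkl
    have hfun : e.coord l = B (v l) := LinearMap.ext (he_coord l)
    rw [hfun]
    refine smulRight_mem_of_mem_ker hBr hε hl0 hl1 hl2 hΔ hspan hΓ htrans hL0 htr hbr hAd (hvΔ l) ?_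
    rw [he_dual, if_neg (Ne.symm hkl)]
  -- `E_{kk} - E_{k₀k₀} ∈ L`
  rcases isEmpty_or_nonempty b with hb0 | ⟨⟨k₀⟩⟩
  · have : Y = 0 := by
      refine e.ext fun i => ?_
      exact (IsEmpty.false i).elim
    rw [this]; exact L.zero_mem
  have hD : ∀ k, (e.coord k).smulRight (e k) - (e.coord k₀).smulRight (e k₀) ∈ L := by
    intro k
    by_cases hk : k = k₀
    · subst hk; rw [sub_self]; exact L.zero_mem
    have h := hbr _ (hE k k₀ hk) _ (hE k₀ k (Ne.symm hk))
    rwa [coord_smulRight_mul, coord_smulRight_mul, if_pos rfl, if_pos rfl, one_smul, one_smul] at h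
  -- expand `Y`
  set c : b → b → ℂ := fun k l => e.repr (Y (e l)) k with hc
  have htrace : ∑ k, c k k = 0 := by rw [← hY, trace_eq_sum_coord e Y]
  have hYsum : Y = ∑ l, ∑ k, c k l • ((e.coord l).smulRight (e k) -
      if k = l then (e.coord k₀).smulRight (e k₀) else 0) := by
    have h1 : ∑ l, ∑ k, c k l • ((e.coord l).smulRight (e k) -
        if k = l then (e.coord k₀).smulRight (e k₀) else 0) =
        (∑ l, ∑ k, c k l • (e.coord l).smulRight (e k)) -
          ∑ l, ∑ k, c k l • (if k = l then (e.coord k₀).smulRight (e k₀) else 0) := by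
      simp only [smul_sub, Finset.sum_sub_distrib]
    have h2 : ∑ l, ∑ k, c k l • (if k = l then (e.coord k₀).smulRight (e k₀) else (0 : Module.End ℂ W)) =
        (∑ k, c k k) • (e.coord k₀).smulRight (e k₀) := by
      simp only [smul_ite, smul_zero, Finset.sum_ite_eq', Finset.mem_univ, if_true, Finset.sum_smul]
    rw [h1, h2, htrace, zero_smul, sub_zero]
    exact eq_sum_coord_smulRight e Y
  rw [hYsum]
  refine L.sum_mem fun l _ => L.sum_mem fun k _ => L.smul_mem _ ?_
  by_cases hkl : k = l
  · subst hkl; rw [if_pos rfl]; exact hD k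
  · rw [if_neg hkl, sub_zero]; exact hE k l hkl

end Literature.AlgebraicGeometry.HodgeTheory
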